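import Summits.BirchSwinnertonDyer.BirchSwinnertonDyer.Theorems.ThetaPartnerAtTwoSignedMainConjectureCMTwoRankZeroOfPubOfStubs
import Summits.BirchSwinnertonDyer.BirchSwinnertonDyer.Theorems.ThetaPartnerAtTwoSignedMainConjectureCMTwoRankZeroMainConjOfUpToTwoPower
import Literature.NumberTheory.EllipticCurves.Kobayashi2003.SignedPAdicLFunctionUniqueProofs
import HarnessLib

/-!
# Route `ThetaPartnerAtTwo` (TP2), crux K2r0P `SignedMainConjectureCMTwoRankZeroOfPub` (stmt-BirchSwinnertonDyer-24945),
# line `rankzero` v14: the Pollack pair and the period ratio are UNIQUE — both research stubs, and Kobayashi's main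
# conjecture itself, in «one datum suffices» (construction / certificate) form

HONEST FRAMING (cell `pub/bsd-wall`, W-ALL row 1, lead prover `bsd-wall-tp2-p2` g7, 2026-08-28). Nothing here is the crux and
BSD is not proved by any of this. The two registered stubs of skeleton `rankzero` v14 — (LD±2^k)_A
(`stub_signedLowerDivisibilityUpToTwoPowerNonUnitCMTwo`) and (μ♭)_A (`stub_analyticMuFlatNonUnitCMTwo`) — and conjunct 2 of the
crux (`KobayashiMainConjecture A 2 1`) quantify UNIVERSALLY over the period ratio `ϖ` (`ϖ·Ω_A = Ω⁺_f`) and over every Pollack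
pair `(L⁺, L⁻)` at `2` (`IsPollackPair f 2 L⁺ L⁻`). This file records, kernel-checked, that these universal quantifiers are
innocuous: `ϖ` is determined (`Ω_A > 0`, `realPeriodRat_pos_holds`) and a Pollack pair is determined at EVERY prime including
`2` — each component satisfies the parity-`ε` Mazur–Tate congruences, i.e. `IsSignedPAdicLFunction f p ε`, whose solutions are
unique (`Kobayashi2003.IsSignedPAdicLFunction.unique`: values at the `ζ - 1`, `ζ` primitive of order `p^n` with `(-1)^n = ε`,
pin an Iwasawa function; no parity-of-`p` input). Consequently:
* whoever CONSTRUCTS one normalisation `ϖ` and one Pollack pair at `2` with the required identity (the shape in which the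
  Pollack–Rubin port (ER⁺@2) naturally delivers `L♭` as a Coleman image of the elliptic unit, PR04 Thm. 7.2's use of the
  characterisation (10)) has proved the universally quantified statement (§3, §4);
* whoever CERTIFIES (μ♭)_A on ONE computed Pollack pair has certified it for all (§3).

* §1 `isPollackPair_unique`, `kobayashiL_eq_of_isPollackPair`, `forall_isPollackPair_of_exists` — any prime `p`.
* §2 `periodRatio_unique` — `ϖ·Ω_A = Ω⁺_f` determines `ϖ ∈ ℚ`.
* §3 `analyticMuFlatNonUnitCMTwo_of_exists`, `signedLowerDivisibilityUpToTwoPowerNonUnitCMTwo_of_exists` — the two registered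
  stub signatures VERBATIM as conclusions, from their «∃ one pair (and one `ϖ`)» forms.
* §4 `kobayashiMainConjecture_of_exists` — `KobayashiMainConjecture W p ε` (any `p`, `ε`) from one `(ϖ, L⁺, L⁻)` per
  normalised cyclotomic datum and newform.
* §5 (appended) `signedUpToTwoPowerNonUnitCMTwo_of_exists` — the TWO-SIDED (MC±2^k)_A text (v10 / the recommended promote text,
  hypothesis `hup` of p597954) from its «∃ one `ϖ`, one pair» form; `signedMainConjectureCMTwoRankZero_body_of_pub_of_exists` — TURNKEY:
  PUB¹⁰ + (MC±2^k)_A in construction form + (μ♭)_A in certificate form ⇒ the crux BODY at every class member (p597954 ∘ §§1–2).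

References: [Pollack2003] Prop. 6.18, Prop. 6.9 (proof), Lemma 4.7; [Kobayashi2003] Thm. 3.2, (3.4)–(3.5) (p. 7), Conjecture (p. 2);
[PollackRubin2004] Thm. 7.2 and (10) (p > 2 in print).
-/

set_option autoImplicit false
-- the Theorems namespace of this sub repeats the summit name by design (D-0017 nested layout)
set_option linter.dupNamespace false

noncomputable section

open scoped Classical NumberField MatrixGroups ModularForm

open NumberField IsDedekindDomain CongruenceSubgroup

namespace Summit.BirchSwinnertonDyer.BirchSwinnertonDyer.Theorems

open Literature.NumberTheory.EllipticCurves Literature.NumberTheory.GaloisRepresentations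
  WeierstrassCurve ZpExtension Literature.NumberTheory.EllipticCurves.Kobayashi2003
  Literature.NumberTheory.EllipticCurves.IwasawaDual
  Literature.NumberTheory.EllipticCurves.ModularForms Literature.NumberTheory.EllipticCurves.Rank1Residual
  Summit.BirchSwinnertonDyer.Rank1Residual Summit.BirchSwinnertonDyer.Rank1Residual.Supersingular

/-! ## §1. A Pollack pair is unique — at every prime, in particular at `2` -/

/-- **Uniqueness of the Pollack pair** at any prime `p` (no parity hypothesis): if `(L⁺, L⁻)` and `(L⁺', L⁻')` both satisfy
Pollack's signed Mazur–Tate congruences for `f` at `p` (`IsPollackPair`), then `L⁺ = L⁺'` and `L⁻ = L⁻'`. Each component is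
an `IsSignedPAdicLFunction f p ε` (`ε = -1` for `L⁺`: odd levels; `ε = 1` for `L⁻`: even levels), and such solutions are
unique (`IsSignedPAdicLFunction.unique`: an element of `Λ` is determined by its values at the `ζ - 1`, `ζ` primitive of order
`p^n`, `(-1)^n = ε`). [cite: Pollack2003, Prop. 6.18 and Prop. 6.9 (proof)] [cite: Kobayashi2003, Thm. 3.2 (p. 7)] -/
theorem isPollackPair_unique {N : ℕ} [NeZero N] {f : CuspForm (Gamma0 N) 2} {p : ℕ} [Fact p.Prime]
    {Lplus Lminus Lplus' Lminus' : IwasawaAlgebra p}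
    (h : IsPollackPair f p Lplus Lminus) (h' : IsPollackPair f p Lplus' Lminus') :
    Lplus = Lplus' ∧ Lminus = Lminus' :=
  ⟨((isSignedPAdicLFunction_neg_one_iff f p Lplus).mpr h.2.2.1).unique
      ((isSignedPAdicLFunction_neg_one_iff f p Lplus').mpr h'.2.2.1),
    ((isSignedPAdicLFunction_one_iff f p Lminus).mpr h.2.2.2).unique
      ((isSignedPAdicLFunction_one_iff f p Lminus').mpr h'.2.2.2)⟩

/-- Kobayashi's `L^ε_p(E, X)` picked out of a Pollack pair does not depend on the pair (there is only one).
[cite: Kobayashi2003, Thm. 3.2 and (3.4)–(3.5) (p. 7)] -/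
theorem kobayashiL_eq_of_isPollackPair {N : ℕ} [NeZero N] {f : CuspForm (Gamma0 N) 2} {p : ℕ} [Fact p.Prime]
    {Lplus Lminus Lplus' Lminus' : IwasawaAlgebra p}
    (h : IsPollackPair f p Lplus Lminus) (h' : IsPollackPair f p Lplus' Lminus') (ε : ℤˣ) :
    kobayashiL ε Lplus Lminus = kobayashiL ε Lplus' Lminus' := by
  obtain ⟨rfl, rfl⟩ := isPollackPair_unique h h'
  rfl

/-- **«One pair suffices»**: a property holding for SOME Pollack pair of `f` at `p` holds for EVERY Pollack pair of `f` at `p`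
(uniqueness, §1). The door through which a universally quantified Pollack-pair statement is proved by a construction or
checked by a certificate. [cite: Pollack2003, Prop. 6.18 and Prop. 6.9 (proof)] -/
theorem forall_isPollackPair_of_exists {N : ℕ} [NeZero N] {f : CuspForm (Gamma0 N) 2} {p : ℕ} [Fact p.Prime]
    {P : IwasawaAlgebra p → IwasawaAlgebra p → Prop}
    (hex : ∃ Lplus Lminus : IwasawaAlgebra p, IsPollackPair f p Lplus Lminus ∧ P Lplus Lminus) :
    ∀ Lplus Lminus : IwasawaAlgebra p, IsPollackPair f p Lplus Lminus → P Lplus Lminus := by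
  intro Lplus Lminus h
  obtain ⟨L₁, L₂, h₁, hP⟩ := hex
  obtain ⟨rfl, rfl⟩ := isPollackPair_unique h₁ h
  exact hP

/-! ## §2. The period ratio `ϖ` is unique -/

/-- **The period ratio is determined**: `ϖ·Ω_A = Ω⁺_f` and `ϖ'·Ω_A = Ω⁺_f` force `ϖ = ϖ'`, because the real period of an
elliptic curve over `ℚ` is positive (`realPeriodRat_pos_holds`). [cite: CremonaAlgorithms1997, §3.7 (3.7.1)] -/
theorem periodRatio_unique {A : WeierstrassCurve ℚ} [A.IsElliptic] {N : ℕ} {f : CuspForm (Gamma0 N) 2} {ϖ ϖ' : ℚ}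
    (h : (ϖ : ℝ) * A.realPeriodRat = plusPeriod f) (h' : (ϖ' : ℝ) * A.realPeriodRat = plusPeriod f) : ϖ = ϖ' := by
  have hΩ : A.realPeriodRat ≠ 0 := ne_of_gt (A.realPeriodRat_pos_holds : 0 < A.realPeriodRat)
  exact_mod_cast mul_right_cancel₀ hΩ (h.trans h'.symm)

/-! ## §3. The two registered stubs of `rankzero` v14 in «one pair suffices» form -/

/-- **(μ♭)_A from ONE Pollack pair per curve.** If for every rank-`0` CM curve `A` of the class (good supersingular at `2`,
`a₂ = 0`, `2 ∣ #Ш(A)·∏c_ℓ(A)`) and its newform `f` SOME Pollack pair at `2` has `L♭` with a unit coefficient, then the registered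
stub `stub_analyticMuFlatNonUnitCMTwo` holds VERBATIM (every Pollack pair: there is only one, §1). This is the certificate door
for (μ♭)_A: one computed pair per curve. [cite: Pollack2003, Prop. 6.18] [cite: KuriharaOtsuki2006, Rem. 0.2 (3)] -/
theorem analyticMuFlatNonUnitCMTwo_of_exists
    (h : ∀ (A : WeierstrassCurve ℚ) [A.IsElliptic] [A.IsGloballyMinimal],
      A.HasCM → A.analyticRank = 0 → GoodSS A 2 → A.frobeniusTrace 2 = 0 →
      2 ∣ A.shaOrder * A.tamagawaProduct →
      ∀ [NeZero (A.conductorNorm ℤ)] (f : CuspForm (Gamma0 (A.conductorNorm ℤ)) 2),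
      IsNewformOf A f → ∃ Lplus Lminus : IwasawaAlgebra 2, IsPollackPair f 2 Lplus Lminus ∧
        ∃ n : ℕ, IsUnit (PowerSeries.coeff n (kobayashiL 1 Lplus Lminus))) :
    ∀ (A : WeierstrassCurve ℚ) [A.IsElliptic] [A.IsGloballyMinimal],
      A.HasCM → A.analyticRank = 0 → GoodSS A 2 → A.frobeniusTrace 2 = 0 →
      2 ∣ A.shaOrder * A.tamagawaProduct →
      ∀ [NeZero (A.conductorNorm ℤ)] (f : CuspForm (Gamma0 (A.conductorNorm ℤ)) 2),
      IsNewformOf A f → ∀ (Lplus Lminus : IwasawaAlgebra 2), IsPollackPair f 2 Lplus Lminus →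
        ∃ n : ℕ, IsUnit (PowerSeries.coeff n (kobayashiL 1 Lplus Lminus)) := by
  intro A _ _ hcm hr hss ha hdiv _ f hf
  exact forall_isPollackPair_of_exists (h A hcm hr hss ha hdiv f hf)

/-- **(LD±2^k)_A from ONE normalisation and ONE Pollack pair per curve and cyclotomic datum.** If for every rank-`0` CM curve
`A` of the class (off the unit zone), every normalised cyclotomic datum `(κ, γ)` and the newform `f` there EXIST a period ratio
`ϖ` (`ϖ·Ω_A = Ω⁺_f`) and a Pollack pair `(L⁺, L⁻)` at `2` such that every signed Selmer dual datum `D` has `char X⁺ = (g)` with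
`2^{m'}·ι g = 2^m·ϖ·ι(L♭·h)`, then the registered stub `stub_signedLowerDivisibilityUpToTwoPowerNonUnitCMTwo` holds VERBATIM —
`ϖ` and the pair are unique (§§1–2). This is the shape in which the Pollack–Rubin port at `2` ((ER⁺@2): `L♭` as the `+` Coleman
image of the elliptic unit, identified with Pollack's function by the interpolation property) delivers the stub.
[cite: PollackRubin2004, Thm. 7.2 and (10) (p > 2)] [cite: Pollack2003, Prop. 6.18] -/
theorem signedLowerDivisibilityUpToTwoPowerNonUnitCMTwo_of_exists
    (h : ∀ (A : WeierstrassCurve ℚ) [A.IsElliptic] [A.IsGloballyMinimal],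
      A.HasCM → A.analyticRank = 0 → GoodSS A 2 → A.frobeniusTrace 2 = 0 →
      2 ∣ A.shaOrder * A.tamagawaProduct →
      ∀ (κ : ZpExtension ℚ 2) (γ : Field.absoluteGaloisGroup ℚ),
        κ.IsCyclotomic → κ.IsTopGenerator γ → IsCyclotomicVariable 2 γ →
      ∀ [NeZero (A.conductorNorm ℤ)] (f : CuspForm (Gamma0 (A.conductorNorm ℤ)) 2), IsNewformOf A f →
      ∃ (ϖ : ℚ) (Lplus Lminus : IwasawaAlgebra 2), (ϖ : ℝ) * A.realPeriodRat = plusPeriod f ∧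
        IsPollackPair f 2 Lplus Lminus ∧
        ∀ (D : SignedSelmerDualData A κ γ 1),
          ∃ (g h : IwasawaAlgebra 2) (m m' : ℕ), D.charIdeal = Ideal.span {g} ∧
            PowerSeries.C ((2 : ℚ_[2]) ^ m') * iwasawaToPowerSeries 2 g =
              PowerSeries.C ((2 : ℚ_[2]) ^ m * (ϖ : ℚ_[2])) * iwasawaToPowerSeries 2 (kobayashiL 1 Lplus Lminus * h)) :
    ∀ (A : WeierstrassCurve ℚ) [A.IsElliptic] [A.IsGloballyMinimal],
      A.HasCM → A.analyticRank = 0 → GoodSS A 2 → A.frobeniusTrace 2 = 0 →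
      2 ∣ A.shaOrder * A.tamagawaProduct →
      ∀ (κ : ZpExtension ℚ 2) (γ : Field.absoluteGaloisGroup ℚ),
        κ.IsCyclotomic → κ.IsTopGenerator γ → IsCyclotomicVariable 2 γ →
      ∀ [NeZero (A.conductorNorm ℤ)] (f : CuspForm (Gamma0 (A.conductorNorm ℤ)) 2),
        IsNewformOf A f → ∀ (ϖ : ℚ), (ϖ : ℝ) * A.realPeriodRat = plusPeriod f →
      ∀ (Lplus Lminus : IwasawaAlgebra 2), IsPollackPair f 2 Lplus Lminus →
      ∀ (D : SignedSelmerDualData A κ γ 1),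
        ∃ (g h : IwasawaAlgebra 2) (m m' : ℕ), D.charIdeal = Ideal.span {g} ∧
          PowerSeries.C ((2 : ℚ_[2]) ^ m') * iwasawaToPowerSeries 2 g =
            PowerSeries.C ((2 : ℚ_[2]) ^ m * (ϖ : ℚ_[2])) * iwasawaToPowerSeries 2 (kobayashiL 1 Lplus Lminus * h) := by
  intro A _ _ hcm hr hss ha hdiv κ γ hκ hγ hγ' _ f hf ϖ hϖ Lplus Lminus hL D
  obtain ⟨ϖ₀, L₁, L₂, hϖ₀, hL₀, hD⟩ := h A hcm hr hss ha hdiv κ γ hκ hγ hγ' f hf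
  obtain rfl : ϖ = ϖ₀ := periodRatio_unique hϖ hϖ₀
  obtain ⟨rfl, rfl⟩ := isPollackPair_unique hL₀ hL
  exact hD D

/-! ## §4. Kobayashi's main conjecture for `(E, p, ε)` from one `(ϖ, L⁺, L⁻)` per datum -/

/-- **`KobayashiMainConjecture W p ε` in construction form** (any prime `p`, either sign): it suffices, for every normalised
cyclotomic datum `(κ, γ)` and the newform `f`, to produce ONE period ratio `ϖ` with `ϖ·Ω_W = Ω⁺_f` and ONE Pollack pair
`(L⁺, L⁻)` at `p` such that every signed Selmer dual datum `D` is `Λ`-torsion with `char X^ε = (g)`, `ι g = ϖ·ι L^ε` — the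
typed conjecture then holds for EVERY `ϖ` and EVERY Pollack pair, by uniqueness (§§1–2).
[cite: Kobayashi2003, Conjecture (Main Conjecture) (p. 2) and Thm. 3.2 (p. 7)] [cite: Pollack2003, Prop. 6.18] -/
theorem kobayashiMainConjecture_of_exists {W : WeierstrassCurve ℚ} [W.IsElliptic] [W.IsGloballyMinimal]
    {p : ℕ} [Fact p.Prime] {ε : ℤˣ}
    (h : ∀ (κ : ZpExtension ℚ p) (γ : Field.absoluteGaloisGroup ℚ),
      κ.IsCyclotomic → κ.IsTopGenerator γ → IsCyclotomicVariable p γ →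
      ∀ [NeZero (W.conductorNorm ℤ)] (f : CuspForm (Gamma0 (W.conductorNorm ℤ)) 2), IsNewformOf W f →
      ∃ (ϖ : ℚ) (Lplus Lminus : IwasawaAlgebra p), (ϖ : ℝ) * W.realPeriodRat = plusPeriod f ∧
        IsPollackPair f p Lplus Lminus ∧
        ∀ (D : SignedSelmerDualData W κ γ ε), Module.IsTorsion (IwasawaAlgebra p) D.X ∧
          ∃ g : IwasawaAlgebra p, D.charIdeal = Ideal.span {g} ∧
            iwasawaToPowerSeries p g =
              PowerSeries.C (ϖ : ℚ_[p]) * iwasawaToPowerSeries p (kobayashiL ε Lplus Lminus)) :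
    KobayashiMainConjecture W p ε := by
  intro κ γ hκ hγ hγ' _ f hf ϖ hϖ Lplus Lminus hL D
  obtain ⟨ϖ₀, L₁, L₂, hϖ₀, hL₀, hD⟩ := h κ γ hκ hγ hγ' f hf
  obtain rfl : ϖ = ϖ₀ := periodRatio_unique hϖ hϖ₀
  obtain ⟨rfl, rfl⟩ := isPollackPair_unique hL₀ hL
  exact hD D

/-! ## §5. (appended, g7) The TWO-SIDED (MC±2^k)_A in construction form, and the turnkey composition -/

/-- **The two-sided «main conjecture modulo powers of `2`» (MC±2^k)_A from ONE normalisation and ONE Pollack pair per curve and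
cyclotomic datum.** Hypothesis: for every rank-`0` CM class member off the unit zone, every normalised `(κ, γ)` and the newform `f`
there EXIST `ϖ` (`ϖ·Ω_A = Ω⁺_f`) and a Pollack pair `(L⁺, L⁻)` at `2` with `char X⁺ = (g)`, `2^{m'}·ι g = 2^m·ϖ·ι L♭` for every dual
datum `D`. Conclusion: the universally quantified two-sided text (hypothesis `hup` of
`signedMainConjectureCMTwoRankZero_body_of_pub_of_upToTwoPower_of_flat`, p597954; the promote text recommended in PR04-AT-TWO.md §5) —
`ϖ` and the pair are unique (§§1–2). [cite: PollackRubin2004, Thm. 7.2 and 7.3 (p > 2)] [cite: Pollack2003, Prop. 6.18] -/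
theorem signedUpToTwoPowerNonUnitCMTwo_of_exists
    (h : ∀ (A : WeierstrassCurve ℚ) [A.IsElliptic] [A.IsGloballyMinimal],
      A.HasCM → A.analyticRank = 0 → GoodSS A 2 → A.frobeniusTrace 2 = 0 →
      2 ∣ A.shaOrder * A.tamagawaProduct →
      ∀ (κ : ZpExtension ℚ 2) (γ : Field.absoluteGaloisGroup ℚ),
        κ.IsCyclotomic → κ.IsTopGenerator γ → IsCyclotomicVariable 2 γ →
      ∀ [NeZero (A.conductorNorm ℤ)] (f : CuspForm (Gamma0 (A.conductorNorm ℤ)) 2), IsNewformOf A f →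
      ∃ (ϖ : ℚ) (Lplus Lminus : IwasawaAlgebra 2), (ϖ : ℝ) * A.realPeriodRat = plusPeriod f ∧
        IsPollackPair f 2 Lplus Lminus ∧
        ∀ (D : SignedSelmerDualData A κ γ 1),
          ∃ (g : IwasawaAlgebra 2) (m m' : ℕ), D.charIdeal = Ideal.span {g} ∧
            PowerSeries.C ((2 : ℚ_[2]) ^ m') * iwasawaToPowerSeries 2 g =
              PowerSeries.C ((2 : ℚ_[2]) ^ m * (ϖ : ℚ_[2])) * iwasawaToPowerSeries 2 (kobayashiL 1 Lplus Lminus)) :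
    ∀ (A : WeierstrassCurve ℚ) [A.IsElliptic] [A.IsGloballyMinimal],
      A.HasCM → A.analyticRank = 0 → GoodSS A 2 → A.frobeniusTrace 2 = 0 →
      2 ∣ A.shaOrder * A.tamagawaProduct →
      ∀ (κ : ZpExtension ℚ 2) (γ : Field.absoluteGaloisGroup ℚ),
        κ.IsCyclotomic → κ.IsTopGenerator γ → IsCyclotomicVariable 2 γ →
      ∀ [NeZero (A.conductorNorm ℤ)] (f : CuspForm (Gamma0 (A.conductorNorm ℤ)) 2),
        IsNewformOf A f → ∀ (ϖ : ℚ), (ϖ : ℝ) * A.realPeriodRat = plusPeriod f →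
      ∀ (Lplus Lminus : IwasawaAlgebra 2), IsPollackPair f 2 Lplus Lminus →
      ∀ (D : SignedSelmerDualData A κ γ 1),
        ∃ (g : IwasawaAlgebra 2) (m m' : ℕ), D.charIdeal = Ideal.span {g} ∧
          PowerSeries.C ((2 : ℚ_[2]) ^ m') * iwasawaToPowerSeries 2 g =
            PowerSeries.C ((2 : ℚ_[2]) ^ m * (ϖ : ℚ_[2])) * iwasawaToPowerSeries 2 (kobayashiL 1 Lplus Lminus) := by
  intro A _ _ hcm hr hss ha hdiv κ γ hκ hγ hγ' _ f hf ϖ hϖ Lplus Lminus hL D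
  obtain ⟨ϖ₀, L₁, L₂, hϖ₀, hL₀, hD⟩ := h A hcm hr hss ha hdiv κ γ hκ hγ hγ' f hf
  obtain rfl : ϖ = ϖ₀ := periodRatio_unique hϖ hϖ₀
  obtain ⟨rfl, rfl⟩ := isPollackPair_unique hL₀ hL
  exact hD D

/-- **TURNKEY for the crux body from its two research inputs in construction / certificate form.** Grant the ten published inputs
BY NAME (Burungale–Flach, modular parametrisation, entire `L`, GZK, the `p = 2` period-unit fact, Greenberg ×5 — the antecedents of
K2r0P); assume (MC±2^k)_A in the «∃ one `ϖ`, one Pollack pair» form (`hup∃`, what the Pollack–Rubin port at `2` delivers) and (μ♭)_A in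
the «∃ one Pollack pair with a unit coefficient» form (`hμ∃`, what a per-curve computation certifies), both only OFF the unit zone. Then
the BODY of `SignedMainConjectureCMTwoRankZero(OfPub)` holds at every rank-`0` CM `A`, good supersingular at `2`, `a₂ = 0`: §5 and §3
turn the ∃-forms into the ∀-forms and p597954 (`signedMainConjectureCMTwoRankZero_body_of_pub_of_upToTwoPower_of_flat`) composes.
[cite: PollackRubin2004, Thm. 7.3 (p > 2)] [cite: Kobayashi2003, Conjecture (p. 2)] [cite: BurungaleFlach2024, Thm. 1.1] -/
theorem signedMainConjectureCMTwoRankZero_body_of_pub_of_exists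
    (hBF : bsdTriple_of_hasCM_of_L_one_ne_zero)
    (hmod : nonempty_modularParametrizationData) (hLrat : hasEntireLFunction_rat)
    (hGZK : rank_eq_analyticRank_of_analyticRank_le_one)
    (h2 : Literature.NumberTheory.EllipticCurves.realPeriodRat_eq_unit_mul_plusPeriod_two)
    (hC : Greenberg1999.casselsSurjectivity_H1Sigma ℚ)
    (h412 : Greenberg1999.prop412_noFiniteSubmodule_H1Sigma_of_rank_one)
    (hcork : Greenberg1999.h1Sigma_zpCorank_le_degree ℚ)
    (hP108 : Greenberg1999.localQuotient_restriction_surjective ℚ)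
    (hWL : Greenberg1999.h1SigmaInfty_rank_eq_one)
    (hupE : ∀ (A : WeierstrassCurve ℚ) [A.IsElliptic] [A.IsGloballyMinimal],
      A.HasCM → A.analyticRank = 0 → GoodSS A 2 → A.frobeniusTrace 2 = 0 →
      2 ∣ A.shaOrder * A.tamagawaProduct →
      ∀ (κ : ZpExtension ℚ 2) (γ : Field.absoluteGaloisGroup ℚ),
        κ.IsCyclotomic → κ.IsTopGenerator γ → IsCyclotomicVariable 2 γ →
      ∀ [NeZero (A.conductorNorm ℤ)] (f : CuspForm (Gamma0 (A.conductorNorm ℤ)) 2), IsNewformOf A f →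
      ∃ (ϖ : ℚ) (Lplus Lminus : IwasawaAlgebra 2), (ϖ : ℝ) * A.realPeriodRat = plusPeriod f ∧
        IsPollackPair f 2 Lplus Lminus ∧
        ∀ (D : SignedSelmerDualData A κ γ 1),
          ∃ (g : IwasawaAlgebra 2) (m m' : ℕ), D.charIdeal = Ideal.span {g} ∧
            PowerSeries.C ((2 : ℚ_[2]) ^ m') * iwasawaToPowerSeries 2 g =
              PowerSeries.C ((2 : ℚ_[2]) ^ m * (ϖ : ℚ_[2])) * iwasawaToPowerSeries 2 (kobayashiL 1 Lplus Lminus))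
    (hμE : ∀ (A : WeierstrassCurve ℚ) [A.IsElliptic] [A.IsGloballyMinimal],
      A.HasCM → A.analyticRank = 0 → GoodSS A 2 → A.frobeniusTrace 2 = 0 →
      2 ∣ A.shaOrder * A.tamagawaProduct →
      ∀ [NeZero (A.conductorNorm ℤ)] (f : CuspForm (Gamma0 (A.conductorNorm ℤ)) 2),
      IsNewformOf A f → ∃ Lplus Lminus : IwasawaAlgebra 2, IsPollackPair f 2 Lplus Lminus ∧
        ∃ n : ℕ, IsUnit (PowerSeries.coeff n (kobayashiL 1 Lplus Lminus)))
    (A : WeierstrassCurve ℚ) [A.IsElliptic] [A.IsGloballyMinimal]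
    (hcm : A.HasCM) (hr : A.analyticRank = 0) (hss : GoodSS A 2) (ha : A.frobeniusTrace 2 = 0) :
    (∀ (κ : ZpExtension ℚ 2) (γ : Field.absoluteGaloisGroup ℚ), κ.IsCyclotomic → κ.IsTopGenerator γ →
      ∀ D : SignedSelmerDualData A κ γ 1, Module.IsTorsion (IwasawaAlgebra 2) D.X ∧ D.mu = 0) ∧
    KobayashiMainConjecture A 2 1 :=
  signedMainConjectureCMTwoRankZero_body_of_pub_of_upToTwoPower_of_flat hBF hmod hLrat hGZK h2 hC h412 hcork hP108 hWL
    (signedUpToTwoPowerNonUnitCMTwo_of_exists hupE) (analyticMuFlatNonUnitCMTwo_of_exists hμE) A hcm hr hss ha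

end Summit.BirchSwinnertonDyer.BirchSwinnertonDyer.Theorems

end
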